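import Mathlib
import HarnessLib

/-!
# Kreĭn strings `S[m, L]`, their Titchmarsh–Weyl functions and Kreĭn's correspondence

A **Kreĭn string** `S[m, L]` consists of a length `0 < L ≤ ∞` and a non-decreasing,
right-continuous, non-negative mass function `m` on `[0, L)` with `m(0-) = 0`; `dm` is its
Lebesgue–Stieltjes measure. The string equation is `dy'(x) + z y(x) dm(x) = 0` on `[0, L)`, read in
integral form `y(x) = y(0) + y'(0-) x - z ∫_{[0,x]} (x - s) y(s) dm(s)`; `φ(x,z)`, `ψ(x,z)` are its
solutions with `φ(0)=1, φ'(0-)=0`, `ψ(0)=0, ψ'(0-)=1`, and the (principal) Titchmarsh–Weyl function is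
`q(z) = lim_{x→L} ψ(x,z)/φ(x,z)`, `z ∉ [0,∞)`. Kreĭn's theorem: `S[m,L] ↦ q` is a bijection onto the
Stieltjes class `N_S` of functions `q(z) = b + ∫_{[0,∞)} dσ(λ)/(λ - z)`, `b ≥ 0`,
`∫ dσ(λ)/(1+λ) < ∞` (Suzuki 2023 §9; Kac–Kreĭn 1974; Tomisaki 1988 §4; Dym–McKean 1976 Ch. 5–6).

## Design

* `KreinString` stores the pair `(L, dm)`: the MASS MEASURE `dm` (a Borel measure on `ℝ` carried by
  `[0, L)` and finite on every `[0, x]`, `x < L`) rather than the function `m`; the two descriptions are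
  equivalent (`m(x) = dm([0,x])` is `KreinString.mass`, conversely `dm` is the Stieltjes measure of `m`).
  This representation is extensional (no junk values of `m` outside `[0,L)`), allows an atom at `0`
  (`m(0) > 0 = m(0-)`) and allows `m(L-) = ∞` with `L < ∞` (the case of Kotani's zeta string), which a
  real-valued `StieltjesFunction` on `ℝ` could not express.
* `φ`, `ψ` are DEFINED by the Picard (Neumann) series of the Volterra–Stieltjes integral equation
  (`KreinString.picard`, `KreinString.phi`, `KreinString.psi`); that they are the unique solutions is the
  named fact `KreinStringFundamentalSystem` (not needed to state anything, only to interpret).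
* `q` is `limUnder` along the end filter `KreinString.toEnd` (`atTop` if `L = ∞`, `𝓝[<] L` otherwise);
  the spectral data `(b, σ)` of `q` are chosen classically (`weylConstant`, `spectralMeasure`, junk `0`
  when `q ∉ N_S`, which by Kreĭn's theorem only happens for the free half-line `S[0, ∞]`).
* `transitionFunction S t = ∫ (1 - cos(√λ t))/λ dσ_S(λ)` (integrand extended by continuity, `t²/2`, at
  `λ = 0`, where `σ_S` may have an atom) and `travelTime S x = ∫_{[0,x]} √(dm/dx)` (density of the
  absolutely continuous part of `dm`; equals `∫₀ˣ √(m')` for absolutely continuous `m`).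
* Named facts (Props, used as hypotheses): `KreinStringFundamentalSystem`, `KreinInverseSpectralTheorem`.
  Kreĭn's representation/extension theorem for helical (screw) functions is in the companion file
  `Literature/Analysis/InverseSpectral/HelicalFunction.lean`.

## Not here

The de Branges / canonical-system (Hamiltonian `trace H = 1`) normalisation of the same objects
(Arov–Dym 2012 §2.6), the dual string, spectral functions other than the principal one, and the
dictionary "helical function on a window ↔ string segment of given travel time" (Dym–McKean 1976 §6).

## References

Suzuki2023 (§9), KacKrein1974, Tomisaki1988 (§4), DymMcKean1976 (Ch. 5–6), ArovDym2012 (§2.6),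
Kotani2021, LangerWinkler1998.
-/

open MeasureTheory Filter Set Topology
open scoped ENNReal

noncomputable section

namespace Literature.Analysis.InverseSpectral

/-- A **Kreĭn string** `S[m, L]`: a length `L ∈ (0, ∞]` together with the mass distribution `dm`, a
Borel measure on `ℝ` carried by `[0, L)` (`dm((-∞,0)) = 0`, `dm([L,∞)) = 0`) with `dm([0,x]) < ∞` for
every `x < L`. Equivalently (`m(x) := dm([0,x])`, see `KreinString.mass`): `m` is non-decreasing,
right-continuous and non-negative on `[0, L)` with `m(0-) = 0`; an atom of `dm` at `0` (i.e. `m(0) > 0`)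
and `m(L-) = ∞` are allowed. [cite: Suzuki2023, §9] -/
structure KreinString where
  /-- The length `L ∈ (0, ∞]` of the string. -/
  length : ℝ≥0∞
  /-- The length is positive. -/
  length_pos : 0 < length
  /-- The mass distribution `dm` of the string (a Borel measure on `ℝ` carried by `[0, L)`). -/
  massMeasure : Measure ℝ
  /-- No mass strictly to the left of `0`, i.e. `m(0-) = 0`. -/
  massMeasure_Iio_zero : massMeasure (Set.Iio 0) = 0
  /-- `m(x) = dm([0, x])` is finite for every `x < L`. -/
  massMeasure_Iic_lt_top : ∀ x : ℝ, ENNReal.ofReal x < length → massMeasure (Set.Iic x) < ⊤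
  /-- No mass at or beyond `L` (vacuous when `L = ∞`). -/
  massMeasure_Ici_eq_zero : ∀ x : ℝ, length ≤ ENNReal.ofReal x → massMeasure (Set.Ici x) = 0

namespace KreinString

variable (S : KreinString)

/-- The parameter interval `[0, L)` of the string `S[m, L]`, as a subset of `ℝ`
(all of `[0, ∞)` when `L = ∞`). [folklore] -/
def dom : Set ℝ := {x : ℝ | 0 ≤ x ∧ ENNReal.ofReal x < S.length}

/-- Unfolding of `KreinString.dom`. [folklore] -/
lemma mem_dom {x : ℝ} : x ∈ S.dom ↔ 0 ≤ x ∧ ENNReal.ofReal x < S.length := Iff.rfl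

/-- The left end `0` belongs to `[0, L)`. [folklore] -/
lemma zero_mem_dom : (0 : ℝ) ∈ S.dom := ⟨le_rfl, by simpa using S.length_pos⟩

/-- The mass function `m(x) = dm([0, x])` of the string (`= 0` for `x < 0`, so `m(0-) = 0`; for `x ≥ L`
this is the junk value `(dm([0,L))).toReal`). [cite: Suzuki2023, §9] -/
def mass (x : ℝ) : ℝ := (S.massMeasure (Set.Iic x)).toReal

/-- Unfolding of `KreinString.mass`. [folklore] -/
lemma mass_def (x : ℝ) : S.mass x = (S.massMeasure (Set.Iic x)).toReal := rfl

/-- `m(x) = 0` for `x < 0` (in particular `m(0-) = 0`). [folklore] -/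
lemma mass_of_neg {x : ℝ} (hx : x < 0) : S.mass x = 0 := by
  have h : S.massMeasure (Set.Iic x) = 0 :=
    measure_mono_null (fun y (hy : y ≤ x) => lt_of_le_of_lt hy hx) S.massMeasure_Iio_zero
  simp [mass, h]

/-- `m ≥ 0`. [folklore] -/
lemma mass_nonneg (x : ℝ) : 0 ≤ S.mass x := ENNReal.toReal_nonneg

/-- `m` is non-decreasing on `[0, L)`. [folklore] -/
lemma monotoneOn_mass : MonotoneOn S.mass S.dom := by
  intro x _ y hy hxy
  exact ENNReal.toReal_mono (S.massMeasure_Iic_lt_top y hy.2).ne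
    (measure_mono (Set.Iic_subset_Iic.mpr hxy))

/-- `y : ℝ → ℂ` is a (continuous) solution of the string equation `dy' + z y dm = 0` on `[0, L)` with
initial data `y(0) = y₀`, `y'(0-) = y₀'`, in the integral form
`y(x) = y₀ + y₀' x - z ∫_{[0,x]} (x - s) y(s) dm(s)` for all `x ∈ [0, L)` (the atom of `dm` at `0`, if
any, is included; the endpoint `s = x` does not contribute). [cite: Suzuki2023, §9] -/
def IsSolution (z y₀ y₀' : ℂ) (y : ℝ → ℂ) : Prop :=
  ContinuousOn y S.dom ∧
    ∀ x ∈ S.dom, y x = y₀ + y₀' * x -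
      z * ∫ s in Set.Icc 0 x, ((x - s : ℝ) : ℂ) * y s ∂S.massMeasure

/-- A solution takes the prescribed value at `0`. [folklore] -/
lemma IsSolution.apply_zero {S : KreinString} {z y₀ y₀' : ℂ} {y : ℝ → ℂ}
    (h : S.IsSolution z y₀ y₀' y) : y 0 = y₀ := by
  have h0 := h.2 0 S.zero_mem_dom
  have hint : ∫ s in Set.Icc (0 : ℝ) 0, (((0 : ℝ) - s : ℝ) : ℂ) * y s ∂S.massMeasure = 0 := by
    refine setIntegral_eq_zero_of_forall_eq_zero (fun s hs => ?_)
    have hs0 : s = 0 := le_antisymm hs.2 hs.1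
    simp [hs0]
  simpa [hint] using h0

/-- Picard iterates of the Volterra–Stieltjes operator `(K f)(x) = ∫_{[0,x]} (x - s) f(s) dm(s)`:
`picard S f 0 = f`, `picard S f (n+1) = K (picard S f n)`. [folklore] -/
def picard (S : KreinString) (f : ℝ → ℝ) : ℕ → ℝ → ℝ
  | 0 => f
  | n + 1 => fun x => ∫ s in Set.Icc 0 x, (x - s) * picard S f n s ∂S.massMeasure

/-- `picard S f 0 = f`. [folklore] -/
@[simp] lemma picard_zero (f : ℝ → ℝ) : S.picard f 0 = f := rfl

/-- The Picard recursion. [folklore] -/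
lemma picard_succ (f : ℝ → ℝ) (n : ℕ) (x : ℝ) :
    S.picard f (n + 1) x = ∫ s in Set.Icc 0 x, (x - s) * S.picard f n s ∂S.massMeasure := rfl

/-- All higher Picard iterates vanish at `x = 0`. [folklore] -/
@[simp] lemma picard_succ_apply_zero (f : ℝ → ℝ) (n : ℕ) : S.picard f (n + 1) 0 = 0 := by
  rw [picard_succ]
  refine setIntegral_eq_zero_of_forall_eq_zero (fun s hs => ?_)
  have hs0 : s = 0 := le_antisymm hs.2 hs.1
  simp [hs0]

/-- The solution `φ(x, z) = ∑ₙ (-z)ⁿ φₙ(x)` of `dy' + z y dm = 0` with `φ(0) = 1`, `φ'(0-) = 0`, defined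
by the Picard series (`φ₀ = 1`, `φₙ₊₁ = K φₙ`); the series converges for every `z ∈ ℂ` and `x ∈ [0,L)`
(see `KreinStringFundamentalSystem`). [cite: Suzuki2023, §9] -/
def phi (z : ℂ) (x : ℝ) : ℂ := ∑' n : ℕ, (-z) ^ n * (S.picard (fun _ => 1) n x : ℂ)

/-- The solution `ψ(x, z) = ∑ₙ (-z)ⁿ ψₙ(x)` of `dy' + z y dm = 0` with `ψ(0) = 0`, `ψ'(0-) = 1`, defined
by the Picard series (`ψ₀(x) = x`, `ψₙ₊₁ = K ψₙ`). [cite: Suzuki2023, §9] -/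
def psi (z : ℂ) (x : ℝ) : ℂ := ∑' n : ℕ, (-z) ^ n * (S.picard (fun s => s) n x : ℂ)

/-- `φ(0, z) = 1`. [folklore] -/
lemma phi_apply_zero (z : ℂ) : S.phi z 0 = 1 := by
  unfold phi
  rw [tsum_eq_single 0]
  · simp
  · intro n hn
    obtain ⟨k, rfl⟩ := Nat.exists_eq_succ_of_ne_zero hn
    simp

/-- `ψ(0, z) = 0`. [folklore] -/
lemma psi_apply_zero (z : ℂ) : S.psi z 0 = 0 := by
  unfold psi
  have h : ∀ n : ℕ, (-z) ^ n * (S.picard (fun s => s) n 0 : ℂ) = 0 := by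
    intro n
    cases n with
    | zero => simp
    | succ k => simp
  simp [h]

/-- The filter "`x → L` inside `[0, L)`": `atTop` when `L = ∞` and the left-neighbourhood filter
`𝓝[<] L` when `L < ∞`. [folklore] -/
def toEnd : Filter ℝ := if S.length = ⊤ then atTop else 𝓝[<] S.length.toReal

/-- The (principal) **Titchmarsh–Weyl function** `q(z) = lim_{x → L} ψ(x, z)/φ(x, z)` of the string
(meaningful for `z ∉ [0, ∞)`; `limUnder` returns a junk value when the limit does not exist, which for
a string other than the free half-line `S[0,∞]` does not happen off `[0,∞)`, see
`KreinInverseSpectralTheorem`). [cite: Suzuki2023, §9] -/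
def principalWeylFunction (z : ℂ) : ℂ :=
  limUnder S.toEnd (fun x => S.psi z x / S.phi z x)

end KreinString

/-- The cut plane `ℂ \ [0, ∞)` on which Titchmarsh–Weyl functions of strings are considered. [folklore] -/
def offNonnegAxis : Set ℂ := {z : ℂ | z.im ≠ 0 ∨ z.re < 0}

/-- Unfolding of `offNonnegAxis`. [folklore] -/
lemma mem_offNonnegAxis {z : ℂ} : z ∈ offNonnegAxis ↔ z.im ≠ 0 ∨ z.re < 0 := Iff.rfl

/-- `(b, σ)` are Stieltjes-representation data for `q`: `b ≥ 0`, `σ` is a Borel measure on `[0, ∞)` with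
`∫ dσ(λ)/(1 + λ) < ∞`, and `q(z) = b + ∫_{[0,∞)} dσ(λ)/(λ - z)` for every `z ∈ ℂ \ [0, ∞)`.
[cite: Suzuki2023, §9] -/
def HasStieltjesRepresentation (q : ℂ → ℂ) (b : ℝ) (σ : Measure ℝ) : Prop :=
  0 ≤ b ∧ σ (Set.Iio 0) = 0 ∧ (∫⁻ t, ENNReal.ofReal ((1 + t)⁻¹) ∂σ) < ⊤ ∧
    ∀ z ∈ offNonnegAxis, q z = (b : ℂ) + ∫ t, ((t : ℂ) - z)⁻¹ ∂σ

/-- The class `N_S ⊂ N` of Stieltjes-type Nevanlinna functions: `q(z) = b + ∫_{[0,∞)} dσ(λ)/(λ - z)`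
with `b ≥ 0` and `∫ dσ(λ)/(1+λ) < ∞` (only the values of `q` off `[0, ∞)` are constrained).
[cite: Suzuki2023, §9] -/
def IsNevanlinnaStieltjes (q : ℂ → ℂ) : Prop :=
  ∃ b : ℝ, ∃ σ : Measure ℝ, HasStieltjesRepresentation q b σ

namespace KreinString

variable (S : KreinString)

open Classical in
/-- The constant `b ≥ 0` in `q_S(z) = b + ∫ dσ(λ)/(λ - z)` (junk value `0` if `q_S ∉ N_S`); by
Tomisaki 1988 §4, `b = inf {x > 0 : m(x) > 0}` is the length of the initial mass-free segment.
[cite: Suzuki2023, §9] -/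
def weylConstant : ℝ :=
  if h : IsNevanlinnaStieltjes S.principalWeylFunction then h.choose else 0

open Classical in
/-- The (principal) **spectral measure** `σ_S` of the string: the measure in
`q_S(z) = b + ∫_{[0,∞)} dσ(λ)/(λ - z)` (junk value `0` if `q_S ∉ N_S`). [cite: Suzuki2023, §9] -/
def spectralMeasure : Measure ℝ :=
  if h : IsNevanlinnaStieltjes S.principalWeylFunction then h.choose_spec.choose else 0

/-- When `q_S ∈ N_S`, `(weylConstant S, spectralMeasure S)` represent `q_S`. [folklore] -/
lemma hasStieltjesRepresentation_spectralMeasure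
    (h : IsNevanlinnaStieltjes S.principalWeylFunction) :
    HasStieltjesRepresentation S.principalWeylFunction S.weylConstant S.spectralMeasure := by
  simp only [weylConstant, spectralMeasure, dif_pos h]
  exact h.choose_spec.choose_spec

/-- The integrand `(1 - cos(√λ · t))/λ` of the transition function, extended by continuity to its
limit `t²/2` at `λ = 0` (the spectral measure may charge `{0}`). [folklore] -/
def transitionKernel (t lam : ℝ) : ℝ :=
  if lam = 0 then t ^ 2 / 2 else (1 - Real.cos (Real.sqrt lam * t)) / lam

/-- The **transition function** `Π_S(t) = ∫_{[0,∞)} (1 - cos(√λ t))/λ dσ_S(λ)` of the string built from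
its principal spectral measure (normalisation requested by route PluckedString: for the zeta string
`σ = Σ_{γ>0} 2 δ_{γ²}` and `Π` is Suzuki's `Ψ(t) = Σ_γ (1 - cos γt)/γ²`, Suzuki 2023 (1.3) and §9).
[folklore] -/
def transitionFunction (t : ℝ) : ℝ := ∫ lam, transitionKernel t lam ∂S.spectralMeasure

/-- The **travel time** (sound-propagation depth) `τ(x) = ∫_{[0,x]} √((dm/dx)(s)) ds`, where `dm/dx`
is the Radon–Nikodym derivative of `dm` with respect to Lebesgue measure (the density of the
absolutely continuous part of `dm`; for absolutely continuous `m` this is `∫₀ˣ √(m'(s)) ds`). Finite for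
`x < L` (Cauchy–Schwarz: `τ(x)² ≤ x · m(x)`); for `x ≥ L` the value may be the junk `0` of a divergent
integral (the zeta string has infinite total travel time). [folklore] -/
def travelTime (x : ℝ) : ℝ :=
  ∫ s in Set.Icc 0 x, Real.sqrt ((S.massMeasure.rnDeriv volume s).toReal)

/-- The string segment `S[m, L']` of `S[m, L]` cut at `0 < L' ≤ L` (mass restricted to `[0, L')`).
[folklore] -/
def truncate (L' : ℝ≥0∞) (h0 : 0 < L') (hL : L' ≤ S.length) : KreinString where
  length := L'
  length_pos := h0
  massMeasure := S.massMeasure.restrict {x : ℝ | ENNReal.ofReal x < L'}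
  massMeasure_Iio_zero :=
    le_antisymm ((Measure.restrict_apply_le _ _).trans_eq S.massMeasure_Iio_zero) zero_le
  massMeasure_Iic_lt_top := fun x hx =>
    (Measure.restrict_apply_le _ _).trans_lt (S.massMeasure_Iic_lt_top x (lt_of_lt_of_le hx hL))
  massMeasure_Ici_eq_zero := fun x hx => by
    rw [Measure.restrict_apply measurableSet_Ici]
    have h : Set.Ici x ∩ {y : ℝ | ENNReal.ofReal y < L'} = ∅ := by
      ext y
      simp only [Set.mem_inter_iff, Set.mem_Ici, Set.mem_setOf_eq, Set.mem_empty_iff_false,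
        iff_false, not_and, not_lt]
      exact fun hy => hx.trans (ENNReal.ofReal_le_ofReal hy)
    rw [h, measure_empty]

/-- `truncate` has the prescribed length. [folklore] -/
@[simp] lemma truncate_length (L' : ℝ≥0∞) (h0 : 0 < L') (hL : L' ≤ S.length) :
    (S.truncate L' h0 hL).length = L' := rfl

/-- The free half-line `S[0, ∞]` (`L = ∞`, no mass at all): the one string whose ratio `ψ/φ = x` has no
finite limit, excluded from Kreĭn's correspondence ("nontrivial `m`" in Tomisaki 1988 §4). [folklore] -/
def IsTrivial (T : KreinString) : Prop := T.length = ⊤ ∧ T.massMeasure = 0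

end KreinString

/-- **Fundamental system of the string equation** (named fact). For every Kreĭn string `S` and every
`z ∈ ℂ`: the Picard series `φ(·, z)` and `ψ(·, z)` are solutions of `dy' + z y dm = 0` on `[0, L)` in
integral form with `φ(0) = 1, φ'(0-) = 0` and `ψ(0) = 0, ψ'(0-) = 1`, and a solution is uniquely
determined on `[0, L)` by its initial data `(y(0), y'(0-))` (Arov–Dym 2012 §2.6, eq. (2.61): "the unique
solutions of the Feller–Kreĭn string equation that satisfy the initial conditions"). [folklore] -/
def KreinStringFundamentalSystem : Prop :=
  ∀ (S : KreinString) (z : ℂ),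
    S.IsSolution z 1 0 (S.phi z) ∧ S.IsSolution z 0 1 (S.psi z) ∧
      ∀ (y₀ y₀' : ℂ) (y₁ y₂ : ℝ → ℂ),
        S.IsSolution z y₀ y₀' y₁ → S.IsSolution z y₀ y₀' y₂ → Set.EqOn y₁ y₂ S.dom

/-- **Kreĭn's inverse spectral theorem for strings** (named fact; Kreĭn 1952, proofs in Kac–Kreĭn 1974
and Dym–McKean 1976 Ch. 5–6; stated as "the correspondence `S[m,L] ↦ N_S` is bijective" in Suzuki 2023
§9 and as "Kreĭn's correspondence `m ∈ M → k ∈ K` is one to one and onto" in Tomisaki 1988 §4).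
Precisely, excluding on the string side the free half-line `S[0, ∞]` (for which `ψ/φ = x → ∞`) and on the
function side `q ≡ 0` (for a string of positive length `q(-s) = ∫₀ᴸ φ(x,-s)⁻² dx > 0`, Tomisaki 1988
(4.1)):
(i) for every other string and every `z ∉ [0, ∞)` the limit `q_S(z) = lim_{x→L} ψ(x,z)/φ(x,z)` exists,
and `q_S ∈ N_S`, i.e. `q_S(z) = b + ∫_{[0,∞)} dσ(λ)/(λ - z)` with `b ≥ 0`, `∫ dσ/(1+λ) < ∞`;
(ii) two such strings with the same `q` off `[0, ∞)` are equal (same `L`, same `dm`);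
(iii) every `q ∈ N_S`, `q ≢ 0`, is `q_S` for some such string.
[cite: Tomisaki1988, §4 Theorem (M. G. Kreĭn)] -/
def KreinInverseSpectralTheorem : Prop :=
  (∀ S : KreinString, ¬ S.IsTrivial →
      (∀ z ∈ offNonnegAxis,
          Tendsto (fun x => S.psi z x / S.phi z x) S.toEnd (𝓝 (S.principalWeylFunction z))) ∧
        IsNevanlinnaStieltjes S.principalWeylFunction) ∧
    (∀ S₁ S₂ : KreinString, ¬ S₁.IsTrivial → ¬ S₂.IsTrivial →
      Set.EqOn S₁.principalWeylFunction S₂.principalWeylFunction offNonnegAxis → S₁ = S₂) ∧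
    (∀ q : ℂ → ℂ, IsNevanlinnaStieltjes q → (∃ z ∈ offNonnegAxis, q z ≠ 0) →
      ∃ S : KreinString, ¬ S.IsTrivial ∧ Set.EqOn S.principalWeylFunction q offNonnegAxis)

/-- Consequence of Kreĭn's theorem packaged for users: a nontrivial string has spectral data, so
`weylConstant`/`spectralMeasure` are not junk. [folklore] -/
theorem KreinString.hasStieltjesRepresentation_of_krein (h : KreinInverseSpectralTheorem)
    (S : KreinString) (hS : ¬ S.IsTrivial) :
    HasStieltjesRepresentation S.principalWeylFunction S.weylConstant S.spectralMeasure :=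
  S.hasStieltjesRepresentation_spectralMeasure (h.1 S hS).2

end Literature.Analysis.InverseSpectral

end
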